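import Literature.LinearAlgebra.TensorNetworks.Basic
import Mathlib.Algebra.BigOperators.Group.List.Basic
import Mathlib.Data.Fintype.Pi
import HarnessLib

/-!
# Sum-of-products variable elimination on a tensor network: table factors, one elimination step, the invariant

Companion to `Basic.lean` (`TensorNetwork R Var Dom Factor`, its `value = Σ_a ∏_f entry f a`). This
file is the machine-independent core of Markov–Shi's contraction step (Thm 4.6, Steps 3–4: "the
minimal cost of contraction is determined by the treewidth"): contracting an index of the network
= eliminating a variable of the sum of products (Markov–Shi, Prop. 4.2: "there is a one-to-one
correspondence of the contraction of an edge in `G` and the elimination of a vertex in `G*`"), in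
Dechter's bucket-elimination form:

* `TFactor R Var Dom` — a factor with an explicit scope (`scope : Finset Var`) and an entry
  function depending only on the scope; `TFactor.one`, `TFactor.mul` (scope = union),
  `TFactor.sumOut v` (sum the variable `v` out; scope = `erase v`), `TFactor.prodList`.
* `TFactor.elimVar v pool` — ONE elimination step on a pool (list) of factors: multiply the factors
  whose scope contains `v`, sum `v` out, keep the others ("when contracting an edge, it computes the
  new tensor according to Equation (1)", Prop. 3.6); `elimList` iterates it along an ordering.
* `TFactor.initPool N` — the factors of the network `N`, and the INVARIANT `Elim.Inv N E pool`:
  the scopes of the pool avoid the set `E` of eliminated variables and, for every assignment `a`,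
  `Σ_{b = a off E} ∏_f entry f b = ∏_{g ∈ pool} g.fn a`; `Elim.inv_initPool` (`E = ∅`),
  **`Elim.Inv.elimVar`** (one step: `E ↦ insert v E`), `Elim.Inv.elimList`, and
  **`Elim.Inv.value_eq`**: once every variable is eliminated, `N.value` is the product of the
  (constant) factors left in the pool.
* scope bookkeeping for the width analysis of the sequel (`mem_scope_prodList`,
  `mem_scope_head_elimVar`, `mem_elimVar_iff`): the factor created by eliminating `v` carries exactly
  the other variables of the factors that carried `v` ("all (current) neighbors of `e` must appear in
  the same bag. Hence its induced width is at most `d`", proof of Prop. 4.2).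

The ORDER in which variables are eliminated (from a rooted tree decomposition, Prop. 4.2) and the
resulting width bound are the sequel's business; nothing here depends on treewidth.

## References

* [MarkovShi2008] I. L. Markov, Y. Shi, *Simulating quantum computation by contracting tensor
  networks*, SIAM J. Comput. 38 (2008) 963–981 (arXiv:quant-ph/0511069): §3 (eq. (1), Prop. 3.6),
  §4 (Def. 4.1, Prop. 4.2 and its proof, Thm. 4.6 Steps 3–4). Read via
  `lit read paper:arxiv-quant-ph_0511069` (pp. 7–10).
* R. Dechter, *Bucket elimination: a unifying framework for reasoning*, Artif. Intell. 113 (1999)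
  41–85, §2 (the elimination step: product of the bucket's functions, summed over the variable).
-/

namespace Literature.LinearAlgebra.TensorNetworks

open Finset

/-- A **table factor** of a sum of products over the commutative semiring `R`: a finite scope of
variables and an entry function of global assignments that depends only on the scope (a rank-`k`
tensor with named indices, Markov–Shi Def. 3.1, in the order-free form of `TensorNetwork`).
[cite: MarkovShi2008, §3 (Def 3.1)] -/
structure TFactor (R : Type*) [CommSemiring R] (Var Dom : Type*) where
  /-- The variables (indices) the factor carries. -/
  scope : Finset Var
  /-- The entries, read off a global assignment. -/
  fn : (Var → Dom) → R
  /-- An entry depends only on the variables in the scope. -/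
  fn_congr : ∀ ⦃a b : Var → Dom⦄, (∀ v ∈ scope, a v = b v) → fn a = fn b

namespace TFactor

variable {R : Type*} [CommSemiring R] {Var Dom Factor : Type*} [DecidableEq Var]

/-- The unit factor: empty scope, constant entry `1`. [folklore] -/
def one : TFactor R Var Dom := ⟨∅, fun _ => 1, fun _ _ _ => rfl⟩

/-- The **product** of two factors: union of the scopes, pointwise product of the entries (the
merged tensor before summation, Markov–Shi eq. (1)). [cite: MarkovShi2008, §3 (eq. (1))] -/
def mul (f g : TFactor R Var Dom) : TFactor R Var Dom where
  scope := f.scope ∪ g.scope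
  fn a := f.fn a * g.fn a
  fn_congr a b h := by
    rw [f.fn_congr fun v hv => h v (mem_union_left _ hv),
      g.fn_congr fun v hv => h v (mem_union_right _ hv)]

/-- **Summing a variable out** of a factor: `(sumOut v f)(a) = Σ_d f(a[v ↦ d])`, scope
`f.scope \ {v}` (the contraction of the index `v`, Markov–Shi eq. (1)). [cite: MarkovShi2008, §3 (eq. (1))] -/
def sumOut [Fintype Dom] (v : Var) (f : TFactor R Var Dom) : TFactor R Var Dom where
  scope := f.scope.erase v
  fn a := ∑ d, f.fn (Function.update a v d)
  fn_congr a b h := by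
    refine sum_congr rfl fun d _ => f.fn_congr fun u hu => ?_
    by_cases huv : u = v
    · subst huv; simp
    · rw [Function.update_of_ne huv, Function.update_of_ne huv]
      exact h u (mem_erase.2 ⟨huv, hu⟩)

/-- The product of a list of factors. [folklore] -/
def prodList (l : List (TFactor R Var Dom)) : TFactor R Var Dom := l.foldr mul one

/-- The entries of a product of factors are the products of the entries. [folklore] -/
theorem fn_prodList (l : List (TFactor R Var Dom)) (a : Var → Dom) :
    (prodList l).fn a = (l.map fun f => f.fn a).prod := by
  induction l with
  | nil => rfl
  | cons f l ih =>
    show f.fn a * (prodList l).fn a = _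
    rw [ih, List.map_cons, List.prod_cons]

/-- A variable lies in the scope of a product iff it lies in the scope of some factor. [folklore] -/
theorem mem_scope_prodList {l : List (TFactor R Var Dom)} {v : Var} :
    v ∈ (prodList l).scope ↔ ∃ f ∈ l, v ∈ f.scope := by
  induction l with
  | nil => simp [prodList, one]
  | cons f l ih =>
    show v ∈ f.scope ∪ (prodList l).scope ↔ _
    rw [mem_union, ih]
    simp

/-- **One elimination step** (Markov–Shi Prop. 3.6 / Dechter's bucket step): the factors of the pool
carrying `v` are multiplied and `v` is summed out of the product; the new factor is put in front of
the untouched ones. When no factor carries `v` the new factor is the constant `|Dom|` (the value of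
a network sums over every variable, cf. `TensorNetwork.value_of_isEmpty_factor`).
[cite: MarkovShi2008, §3 (Prop 3.6) and §4 (Prop 4.2)] -/
def elimVar [Fintype Dom] (v : Var) (pool : List (TFactor R Var Dom)) : List (TFactor R Var Dom) :=
  sumOut v (prodList (pool.filter fun f => v ∈ f.scope)) :: pool.filter fun f => v ∉ f.scope

/-- **Elimination along an ordering** of variables (head first). [cite: MarkovShi2008, §4 (Def 4.1, contraction ordering)] -/
def elimList [Fintype Dom] (l : List Var) (pool : List (TFactor R Var Dom)) : List (TFactor R Var Dom) :=
  l.foldl (fun p v => elimVar v p) pool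

/-- `elimList` through a cons. [folklore] -/
@[simp] theorem elimList_cons [Fintype Dom] (v : Var) (l : List Var) (pool : List (TFactor R Var Dom)) :
    elimList (v :: l) pool = elimList l (elimVar v pool) := rfl

/-- `elimList` of the empty ordering. [folklore] -/
@[simp] theorem elimList_nil [Fintype Dom] (pool : List (TFactor R Var Dom)) : elimList [] pool = pool := rfl

/-- The scope of the factor created by eliminating `v`: the other variables of the factors that
carried `v`. [cite: MarkovShi2008, §4 (proof of Prop 4.2)] -/
theorem mem_scope_head_elimVar [Fintype Dom] {v x : Var} {pool : List (TFactor R Var Dom)} :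
    x ∈ (sumOut v (prodList (pool.filter fun f => v ∈ f.scope))).scope ↔
      x ≠ v ∧ ∃ f ∈ pool, v ∈ f.scope ∧ x ∈ f.scope := by
  show x ∈ (prodList _).scope.erase v ↔ _
  rw [mem_erase, mem_scope_prodList]
  simp only [List.mem_filter, decide_eq_true_eq, and_assoc]

/-- Membership in the pool after eliminating `v`: the new factor, or an old factor not carrying `v`.
[folklore] -/
theorem mem_elimVar_iff [Fintype Dom] {v : Var} {pool : List (TFactor R Var Dom)} {g : TFactor R Var Dom} :
    g ∈ elimVar v pool ↔
      g = sumOut v (prodList (pool.filter fun f => v ∈ f.scope)) ∨ (g ∈ pool ∧ v ∉ g.scope) := by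
  simp [elimVar, List.mem_filter]

/-- The factor of the network `N` at `u` (its scope and entries). [cite: MarkovShi2008, §3 (Def 3.3)] -/
def ofNetwork (N : TensorNetwork R Var Dom Factor) (u : Factor) : TFactor R Var Dom :=
  ⟨N.scope u, N.entry u, N.entry_congr u⟩

/-- The **initial pool** of a network: one factor per tensor. [cite: MarkovShi2008, §3 (Def 3.3)] -/
noncomputable def initPool [Fintype Factor] (N : TensorNetwork R Var Dom Factor) : List (TFactor R Var Dom) :=
  (univ : Finset Factor).toList.map (ofNetwork N)

end TFactor

/-! ### The invariant of elimination -/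

namespace Elim

variable {R : Type*} [CommSemiring R] {Var Dom Factor : Type*}
variable [Fintype Var] [DecidableEq Var] [Fintype Dom] [DecidableEq Dom] [Fintype Factor]

/-- The assignments agreeing with `a` off the set `E` (of eliminated variables). [folklore] -/
def agreeOff (E : Finset Var) (a : Var → Dom) : Finset (Var → Dom) :=
  univ.filter fun b => ∀ v, v ∉ E → b v = a v

/-- Off the empty set only `a` agrees with `a`. [folklore] -/
theorem agreeOff_empty (a : Var → Dom) : agreeOff (∅ : Finset Var) a = {a} := by
  ext b
  simp only [agreeOff, notMem_empty, not_false_eq_true, forall_const, mem_filter, mem_univ,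
    true_and, mem_singleton]
  exact ⟨fun h => funext h, fun h v => by rw [h]⟩

/-- Off everything, everything agrees. [folklore] -/
theorem agreeOff_univ (a : Var → Dom) : agreeOff (univ : Finset Var) a = univ := by
  ext b
  simp [agreeOff]

/-- Splitting the assignments agreeing off `insert v E` by their value at `v ∉ E`: those with value
`d` are exactly the assignments agreeing with `a[v ↦ d]` off `E`. [folklore] -/
theorem filter_agreeOff_insert {E : Finset Var} {v : Var} (hv : v ∉ E) (a : Var → Dom) (d : Dom) :
    (agreeOff (insert v E) a).filter (fun b => b v = d) = agreeOff E (Function.update a v d) := by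
  ext b
  simp only [agreeOff, mem_filter, mem_univ, true_and, mem_insert, not_or]
  constructor
  · rintro ⟨hb, hbv⟩ u huE
    by_cases huv : u = v
    · subst huv; simp [hbv]
    · rw [Function.update_of_ne huv]; exact hb u ⟨huv, huE⟩
  · intro hb
    refine ⟨fun u hu => ?_, ?_⟩
    · have := hb u hu.2; rwa [Function.update_of_ne hu.1] at this
    · simpa using hb v hv

/-- **The invariant of elimination.** After eliminating the variables `E` from the network `N`,
the pool's scopes avoid `E` and, for every assignment `a`, the partial sum of the network over the
eliminated variables (the other variables frozen at `a`) is the product of the pool's entries at `a`.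
[cite: MarkovShi2008, §3 (Prop 3.6: "the algorithm stores the tensors of each vertex … computes the new tensor according to Equation (1)")] -/
structure Inv (N : TensorNetwork R Var Dom Factor) (E : Finset Var) (pool : List (TFactor R Var Dom)) : Prop where
  /-- Eliminated variables occur in no scope. -/
  disjoint : ∀ f ∈ pool, Disjoint f.scope E
  /-- The partial sum over the eliminated variables is the product of the pool. -/
  sum_eq : ∀ a : Var → Dom, ∑ b ∈ agreeOff E a, ∏ u, N.entry u b = (pool.map fun f => f.fn a).prod

/-- **Nothing eliminated**: the initial pool satisfies the invariant with `E = ∅`. [folklore] -/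
theorem inv_initPool (N : TensorNetwork R Var Dom Factor) : Inv N ∅ (TFactor.initPool N) := by
  refine ⟨fun f _ => disjoint_empty_right _, fun a => ?_⟩
  rw [agreeOff_empty, sum_singleton, TFactor.initPool, List.map_map]
  exact (prod_map_toList _ _).symm

/-- **One elimination step preserves the invariant** (`E ↦ insert v E` for a fresh `v`): split the
partial sum by the value of `v`, apply the invariant at `a[v ↦ d]`, factor out the pool members not
carrying `v` (their entries do not see the update) and recognise `Σ_d ∏_{f ∋ v} f(a[v ↦ d])` as
the entry of the new factor. [cite: MarkovShi2008, §3 (eq. (1), Prop 3.6)] -/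
theorem Inv.elimVar {N : TensorNetwork R Var Dom Factor} {E : Finset Var}
    {pool : List (TFactor R Var Dom)} (h : Inv N E pool) {v : Var} (hv : v ∉ E) :
    Inv N (insert v E) (TFactor.elimVar v pool) := by
  classical
  refine ⟨fun g hg => ?_, fun a => ?_⟩
  · rcases TFactor.mem_elimVar_iff.1 hg with rfl | ⟨hg, hvg⟩
    · rw [disjoint_left]
      intro x hx
      obtain ⟨hxv, f, hf, -, hxf⟩ := TFactor.mem_scope_head_elimVar.1 hx
      rw [mem_insert, not_or]
      exact ⟨hxv, disjoint_left.1 (h.disjoint f hf) hxf⟩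
    · exact disjoint_insert_right.2 ⟨hvg, h.disjoint g hg⟩
  · -- split by the value at `v`
    rw [← sum_fiberwise (agreeOff (insert v E) a) (fun b => b v) (fun b => ∏ u, N.entry u b)]
    simp_rw [filter_agreeOff_insert hv, h.sum_eq]
    -- split the pool into the factors carrying `v` and the others
    set has := pool.filter fun f => v ∈ f.scope with hhas
    set rest := pool.filter fun f => v ∉ f.scope with hrest
    have hsplit : ∀ c : Var → Dom, (pool.map fun f => f.fn c).prod =
        (has.map fun f => f.fn c).prod * (rest.map fun f => f.fn c).prod := by
      intro c
      rw [← List.prod_append, ← List.map_append]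
      have hperm : (has ++ rest).Perm pool := by
        have h1 := List.filter_append_perm (fun f : TFactor R Var Dom => decide (v ∈ f.scope)) pool
        have h2 : rest = pool.filter fun f => !decide (v ∈ f.scope) :=
          List.filter_congr fun f _ => by simp
        rw [hhas, h2]
        exact h1
      exact (hperm.map _).prod_eq.symm
    have hrest_const : ∀ d : Dom, (rest.map fun f => f.fn (Function.update a v d)).prod =
        (rest.map fun f => f.fn a).prod := by
      intro d
      congr 1
      refine List.map_congr_left fun f hf => f.fn_congr fun u hu => ?_
      have hvf : v ∉ f.scope := by simpa using (List.mem_filter.1 hf).2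
      have huv : u ≠ v := fun h => hvf (h ▸ hu)
      rw [Function.update_of_ne huv]
    simp_rw [hsplit, hrest_const, ← sum_mul]
    -- the new factor
    rw [TFactor.elimVar, List.map_cons, List.prod_cons]
    congr 1
    show ∑ d, (has.map fun f => f.fn (Function.update a v d)).prod =
      ∑ d, (TFactor.prodList has).fn (Function.update a v d)
    simp_rw [TFactor.fn_prodList]

/-- **Elimination along an ordering preserves the invariant** (fresh, duplicate-free variables).
[cite: MarkovShi2008, §4 (Def 4.1)] -/
theorem Inv.elimList {N : TensorNetwork R Var Dom Factor} :
    ∀ (l : List Var) {E : Finset Var} {pool : List (TFactor R Var Dom)}, Inv N E pool → l.Nodup →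
      (∀ v ∈ l, v ∉ E) → Inv N (E ∪ l.toFinset) (TFactor.elimList l pool)
  | [], E, pool, h, _, _ => by simpa using h
  | v :: l, E, pool, h, hnd, hfresh => by
    rw [List.nodup_cons] at hnd
    have hv : v ∉ E := hfresh v List.mem_cons_self
    have h' := (h.elimVar hv).elimList l hnd.2 fun u hu => by
      rw [mem_insert, not_or]
      exact ⟨fun huv => hnd.1 (huv ▸ hu), hfresh u (List.mem_cons_of_mem v hu)⟩
    have hE : insert v E ∪ l.toFinset = E ∪ (v :: l).toFinset := by
      ext x
      simp only [mem_union, mem_insert, List.toFinset_cons, List.mem_toFinset]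
      tauto
    rw [TFactor.elimList_cons, ← hE]
    exact h'

/-- **When every variable has been eliminated, the value of the network is the product of the pool**
(whose factors have empty scopes, i.e. are constants). [cite: MarkovShi2008, §3 (Prop 3.5–3.6: the final rank-0 tensor)] -/
theorem Inv.value_eq {N : TensorNetwork R Var Dom Factor} {pool : List (TFactor R Var Dom)}
    (h : Inv N univ pool) (a : Var → Dom) : N.value = (pool.map fun f => f.fn a).prod := by
  rw [← h.sum_eq a, agreeOff_univ]
  rfl

/-- After a full elimination the pool's factors are constants (empty scopes). [folklore] -/
theorem Inv.scope_eq_empty {N : TensorNetwork R Var Dom Factor} {pool : List (TFactor R Var Dom)}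
    (h : Inv N univ pool) {f : TFactor R Var Dom} (hf : f ∈ pool) : f.scope = ∅ :=
  eq_empty_of_forall_notMem fun x hx => disjoint_left.1 (h.disjoint f hf) hx (mem_univ x)

/-- **Correctness of variable elimination** (Markov–Shi's contraction of a closed network along any
ordering of all its indices, Thm 4.6 Step 4): eliminating every variable once, in any order, from
the initial pool leaves constants whose product is the value of the network.
[cite: MarkovShi2008, §3 (Prop 3.5, Prop 3.6) and §4 (Def 4.1)] -/
theorem value_eq_prod_elimList (N : TensorNetwork R Var Dom Factor) {l : List Var} (hnd : l.Nodup)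
    (hall : ∀ v, v ∈ l) (a : Var → Dom) :
    N.value = ((TFactor.elimList l (TFactor.initPool N)).map fun f => f.fn a).prod := by
  have h := (inv_initPool N).elimList l hnd fun v _ => notMem_empty v
  have huniv : (∅ : Finset Var) ∪ l.toFinset = univ := by
    ext v; simp [hall v]
  rw [huniv] at h
  exact h.value_eq a

end Elim

end Literature.LinearAlgebra.TensorNetworks
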